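import Literature.MathematicalPhysics.QuantumFieldTheory.Balaban1983to89.B9Cor35CDirCarrierQLetters
import Literature.MathematicalPhysics.QuantumFieldTheory.Balaban1983to89.B9Cor35GpDirAtCubeLetters
import Literature.MathematicalPhysics.QuantumFieldTheory.Balaban1983to89.B9Cor35CinvAtCubeLetters

/-!
# `Balaban1983to89.B9Cor35CDirEngineAtCarrier` — [Balaban1985BackgroundPropagators] COROLLARY 3.5 p. 407 ∕ p. 409 l. 1–5 FOR PRINT's DIRICHLET THIRD CUBE LETTER
# `C_□ = (Q′_□G′_□²Q′*_□)⁻¹`: THEOREM 3.4's `C`-CLAUSE (p. 403 (3.65)–(3.67)) AT `U = 1` ON THE CARRIER `𝔖 × ι`, UNIFORMLY IN THE MEMBER AND THE COVER CUBE —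
# r06's `B9Thm34InvBlk.thm34_Cinv_uniform_blk` RUN with every `A`-independent binder DISCHARGED (UNITS 1–2, FILES U6b-i∕ii) (ROAD (I) U6b-iii; seat dag-n06-c g33)

statement-level skeleton of published theorems with citation tags; proofs where landed; nothing here is a claim about the Yang–Mills mass gap

## What this file does (mathematically)

[Balaban1985BackgroundPropagators] Cor. 3.5 p. 407 («The theorems hold also for the operators (3.24), (3.25) … with U = 1») read at the cube sequence's
Dirichlet letters (p. 409 l. 1–5): Theorem 3.4's `C`-step (p. 403: `Q′(U′U)G′²(U′U)Q′*(U′U) = Q′G′²Q′* + C′(A)`, (3.66)–(3.67), «the inverse satisfies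
Theorem 3.2») for `C_□`.  r06's carrier-generic engine `thm34_Cinv_uniform_blk` is invoked ONCE on `P := 𝔖 × ι` (`𝔖` the blocks inside `Ω₀(□)`,
`blkP := val ∘ fst`) with: the cube geometry `geoCK i □` and its axioms, [4] (2.61) and the p. 398 scale transfers (r05 FILE 5a), the (3.60) data at the knit
cube legs (r05 FILE 5b), `Gp := GpDirK` with Theorem 3.1 (UNIT 2 `cor35_GpDir_cube` (b)), `Qc ∕ Qcs := QcR 1 ∕ QcsR 1` (U6b-ii `hasMajorantHom_QcR ∕ QcsR`),
`Linv := CinvR 1` with `hLinv_CinvR` and `thm32_CinvR` (U6b-i), `Fc ∕ Fcs := FcR Ṽ ∕ FcsR Ṽ` (U6b-ii).  Conclusion ★★★ `cor35_CDir_carrier`: constants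
`δ, B > 0`, thresholds `M₀, T₀, N₀`, `a₁ > 0` (functions of `d, L, M₂, C_q`) such that for every member above threshold, cover cube, `0 ≤ α₁ ≤ a₁`, vector
potential `A` with the blockwise (3.37) bounds and (3.59) kernels, and field `Ṽ` whose knit-cube averaging letters obey the pointwise (3.59) sizes `C_q·α₁`:
the carrier word `QcR Ṽ ∘ (G′_□(Ṽ)·G′_□(Ṽ)) ∘ QcsR Ṽ` (`G′_□(Ṽ)` = the engine's `gPrimeExtEnd Gp (conj b V′(A)·Gp)`) has a two-sided inverse `Tinv` on
`𝔖 × ι` with the Theorem-3.2 majorant `B·ℓ(a)^{−4}·e^{−δd(a,a′)}`.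

## Status

Printed-statement pass + proof body (proof-backed; a port in the tree's vocabulary; assembly): [Balaban1985BackgroundPropagators] pp. 400–403, 407, 409,
re-read 2026-08-31.  Honest label: the `C`-clause at the Dirichlet letter in the ENGINE's letters (`gPrimeExtEnd …`, `Tinv`); the identification of `Tinv`
with def-Y's `XinvCubeDY(Ṽ)` read on the carrier needs the Dirichlet (3.60) identity for `DpDirK − conj b V′(A)` (UNIT 3) and is NOT done here; the
`A`-dependent (3.37)∕(3.59) data stay hypotheses.  Node N06 of the `pub-ymgap` DAG is NOT discharged here and the Yang–Mills mass gap is NOT proved here.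
NEW file; nothing landed is modified.  No `sorry`, no `axiom`, no `instance`, no `notation`.  Net new unproved facts: 0.  Cell `pub-ymgap` (HUMAN RULING
D-0062), node N06 [B9], seat `pub-ymgap-dag-n06-c` (g33), 2026-08-31.
RELATED, NOT DUPLICATED (searched 2026-08-31: `rg 'cor35_CDir_carrier'` over `Literature ∕ Summits` = ∅): r05 `B9Cor35CinvAtCubeLetters.cor35_Cinv_cube` (the
WHOLE-TORUS letter on all blocks; this file is its Dirichlet twin on the carrier and copies its assembly), UNIT 2 `B9Cor35GpDirAtCubeLetters.cor35_GpDir_cube`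
(USED BY NAME).
-/

noncomputable section

namespace Literature.MathematicalPhysics.QuantumFieldTheory.Balaban1983to89.B9Cor35CDirEngineAtCarrier

open B6KLevelCensusIndexV1 (KIdx kGeo)
open B6Cover236MultiLevelBlocks (cubes)
open B6RandomWalk (HasMajorant BlockSupp hasMajorant_mono Triangle254 Ineq261 c1_nonneg)
open B6RandomWalkHom (HasMajorantHom hasMajorantHom_mono)
open B9Thm34Ext (toB6)
open B9Ineq347 (ScaleTransfer)
open B9Eq352DivFormLetters (conj)
open B9Eq352GradLetters (diffLetter)
open B9Eq360Vprime (gPrimeExtEnd)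
open B9Eq360VprimeLetters (vPrimeConc)
open B9Eq39Adjoint (covD covDstar)
open B9Eq352DivForm (tauB)
open B9Thm34InvBlk (thm34_Cinv_uniform_blk)
open B9CubeLettersBondOpsL0 (BlkCubeY qpKc qpsKc QpCubeY QpsCubeY)
open B9Eq360DeltaPrimeACubeY (blkCubeY kQCubeY sQCubeY)
open B9CubeGeometryInputs (geoCK geoCK_len geoCK_eta geoCK_eta_pos geoCK_len_pos geoCK_eta_le_len geoCK_dist_axioms stencil_geoCK geoCK_site_nonempty hST_geoCK
  exists_h261_geoCK N1 RM1)
open B9Cor35GpCubeInputsAtOne (wK cfunK wK_nonneg card_block_mul_wK_le norm_kQCubeY_one_le norm_sQCubeY_one_le abs_cfunK_le)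
open B9Cor35GpDirInputsAtOne (dirDomY GpDirK)
open B9Cor35GpDirAtCubeLetters (cor35_GpDir_cube)
open B9Cor35CinvAtCubeLetters (kernel_rate_mono)
open B9Cor35CDirCarrierAtOne (SBlk QcR QcsR CinvR hLinv_CinvR thm32_CinvR)
open B9Cor35CDirCarrierQLetters (hasMajorantHom_QcR hasMajorantHom_QcsR FcR FcsR QcR_eq_add QcsR_eq_add hasMajorantHom_FcR hasMajorantHom_FcsR)
open Node00 (SiteY CfgY toKT shiftY)
open Node00.OpsYCubeKnitPar (parKnitCubeY parKnitCubeY_one)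

variable {d ℓ : ℕ} {hd : 1 ≤ d + 1} {hL : Odd (ℓ + 1) ∧ 1 < ℓ + 1} {b₀ b₁ : ℝ}
variable {𝔸 : Type} [NormedRing 𝔸] [NormedAlgebra ℂ 𝔸] [CompleteSpace 𝔸]
variable {ι : Type} [Fintype ι] (b : Module.Basis ι ℝ 𝔸)

/-- ★★★ **COROLLARY 3.5 FOR PRINT's DIRICHLET THIRD CUBE LETTER — THEOREM 3.4's `C`-CLAUSE AT `U = 1` ON THE CARRIER `𝔖 × ι`, UNIFORMLY IN THE MEMBER AND THE
COVER CUBE** (the engine's letters; all `A`-independent binders discharged; see the module doc for the dictionary).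
[cite: Balaban1985BackgroundPropagators, Cor. 3.5 p.407, Thm 3.4 p.400, (3.65)–(3.67) p.403, Thm 3.2 (3.48) p.398, (3.57)–(3.60) pp.401–402, p.409 l.1–5; Balaban1984PropagatorsII, Prop. 2.3 p.238, Lemma 2.1 p.234] -/
theorem cor35_CDir_carrier [DecidableEq ι] (d ℓ : ℕ) (hℓ : 1 ≤ ℓ) (Cq M₂ : ℝ) (hCq : 0 ≤ Cq) (hM₂ : 0 ≤ M₂) (hrepr : ∀ (v : 𝔸) (j : ι), |b.repr v j| ≤ M₂ * ‖v‖)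
    (h1 : ‖(1 : 𝔸)‖ ≤ 1) :
    ∃ δ B M₀ T₀ : ℝ, ∃ N₀ : ℕ, 0 < δ ∧ 0 < B ∧ ∃ a₁ : ℝ, 0 < a₁ ∧
    ∀ {hd : 1 ≤ d + 1} {hL : Odd (ℓ + 1) ∧ 1 < ℓ + 1} {b₀ b₁ : ℝ} (i : KIdx d ℓ hd hL b₀ b₁) (c : ↥(cubes (toKT i).D.toDomains)) (Rr : ℝ) (H : Prop),
      M₀ ≤ ((ℓ : ℝ) + 1) * (toKT i).Mh → N₀ + 1 ≤ (toKT i).R * ((ℓ + 1) * (toKT i).Mh) → T₀ ≤ RM1 i →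
    ∀ (α₁ : ℝ), 0 ≤ α₁ → α₁ ≤ a₁ →
    ∀ (A : Fin (d + 1) → SiteY i → 𝔸) (kF : BlkCubeY i c → SiteY i → 𝔸 →L[ℝ] 𝔸) (sF : SiteY i → 𝔸 →L[ℝ] 𝔸) (V : CfgY 𝔸 i),
      (∀ y x, blkCubeY i c x = y → ‖kF y x‖ ≤ Cq * α₁ * wK i c y) → (∀ x, ‖sF x‖ ≤ Cq * α₁) →
      (∀ ν k x, ‖(((geoCK i c).eta : ℂ)⁻¹) • covDstar (shiftY i) (fun _ _ => (1 : 𝔸ˣ)) ν (A k) x‖ ≤ α₁ * ((geoCK i c).len (blkCubeY i c x) ^ 2)⁻¹) →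
      (∀ k x, ‖A k x‖ ≤ α₁ * ((geoCK i c).len (blkCubeY i c x))⁻¹) →
      (∀ ν k x, ‖tauB (shiftY i) (fun _ _ => (1 : 𝔸ˣ)) ν (A k) x‖ ≤ α₁ * ((geoCK i c).len (blkCubeY i c x))⁻¹) →
      (∀ z w : SiteY i, ‖(parKnitCubeY i c V z w : 𝔸)‖ ≤ 1 ∧ ‖(((parKnitCubeY i c V z w)⁻¹ : 𝔸ˣ) : 𝔸)‖ ≤ 1) →
      (∀ (s : BlkCubeY i c) (lam : SiteY i → 𝔸),
        ‖(QpCubeY i c (parKnitCubeY i c) V lam - QpCubeY i c (parKnitCubeY i c) (fun _ _ => 1) lam) s‖ ≤ Cq * α₁ * ∑ z, |qpKc i c s z| * ‖lam z‖) →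
      (∀ (z : SiteY i) (nu : BlkCubeY i c → 𝔸),
        ‖(QpsCubeY i c (parKnitCubeY i c) V nu - QpsCubeY i c (parKnitCubeY i c) (fun _ _ => 1) nu) z‖ ≤ Cq * α₁ * ∑ s, |qpsKc i c z s| * ‖nu s‖) →
    ∃ Tinv : Module.End ℝ (↥(SBlk i c) × ι → ℝ),
      Tinv * (QcR b i c V ∘ₗ
        ((gPrimeExtEnd (GpDirK b i c (parKnitCubeY i c)) (conj b (vPrimeConc (shiftY i) (fun _ _ => (1 : 𝔸ˣ)) (geoCK i c).eta A (blkCubeY i c)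
            (kQCubeY i c (parKnitCubeY i c) (fun _ _ => 1)) kF (sQCubeY i c (parKnitCubeY i c) (fun _ _ => 1)) sF (cfunK i c)) * GpDirK b i c (parKnitCubeY i c))) *
         (gPrimeExtEnd (GpDirK b i c (parKnitCubeY i c)) (conj b (vPrimeConc (shiftY i) (fun _ _ => (1 : 𝔸ˣ)) (geoCK i c).eta A (blkCubeY i c)
            (kQCubeY i c (parKnitCubeY i c) (fun _ _ => 1)) kF (sQCubeY i c (parKnitCubeY i c) (fun _ _ => 1)) sF (cfunK i c)) * GpDirK b i c (parKnitCubeY i c)))) ∘ₗ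
        QcsR b i c V) = 1 ∧
      (QcR b i c V ∘ₗ
        ((gPrimeExtEnd (GpDirK b i c (parKnitCubeY i c)) (conj b (vPrimeConc (shiftY i) (fun _ _ => (1 : 𝔸ˣ)) (geoCK i c).eta A (blkCubeY i c)
            (kQCubeY i c (parKnitCubeY i c) (fun _ _ => 1)) kF (sQCubeY i c (parKnitCubeY i c) (fun _ _ => 1)) sF (cfunK i c)) * GpDirK b i c (parKnitCubeY i c))) *
         (gPrimeExtEnd (GpDirK b i c (parKnitCubeY i c)) (conj b (vPrimeConc (shiftY i) (fun _ _ => (1 : 𝔸ˣ)) (geoCK i c).eta A (blkCubeY i c)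
            (kQCubeY i c (parKnitCubeY i c) (fun _ _ => 1)) kF (sQCubeY i c (parKnitCubeY i c) (fun _ _ => 1)) sF (cfunK i c)) * GpDirK b i c (parKnitCubeY i c)))) ∘ₗ
        QcsR b i c V) * Tinv = 1 ∧
      HasMajorant (g := toB6 (geoCK i c) Rr H) (fun q : ↥(SBlk i c) × ι => (q.1 : BlkCubeY i c)) Tinv
        (fun a a' => B * (geoCK i c).len a ^ (-(4 : ℝ)) * Real.exp (-(δ * (geoCK i c).dist a a'))) := by
  classical
  have hSb : 0 ≤ ∑ j, ‖b j‖ := Finset.sum_nonneg fun j _ => norm_nonneg _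
  -- UNIT 2: Theorem 3.1 for `GpDirK` in conj-`b` form; U6b-i: Theorem 3.2 for `CinvR 1` on the carrier
  obtain ⟨δG, BG, MG, TG, NG, hδG, hBG, aG, -, BB, -, hG⟩ := cor35_GpDir_cube b d ℓ hℓ Cq M₂ hCq hM₂ hrepr h1
  obtain ⟨δ₂, C₂, M₂', hδ₂, hC₂, -, h32⟩ := thm32_CinvR b d ℓ hℓ
  -- one rate below both
  set δ₀ : ℝ := min δG δ₂ with hδ₀def
  have hδ₀ : 0 < δ₀ := lt_min hδG hδ₂
  have hδ₀1 : δ₀ ≤ δG := min_le_left _ _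
  have hδ₀2 : δ₀ ≤ δ₂ := min_le_right _ _
  obtain ⟨dB, h261⟩ := exists_h261_geoCK d ℓ hδ₀
  have hΛf : ∀ α : ℝ, 0 < α → (1 : ℝ) ≤ ((ℓ : ℝ) + 1) ^ 4 := fun α _ =>
    one_le_pow₀ (by linarith [(Nat.cast_nonneg ℓ : (0 : ℝ) ≤ ℓ)])
  set κQ : ℝ := M₂ * (∑ j, ‖b j‖) + 1 with hκQdef
  have hκQ : 0 < κQ := by rw [hκQdef]; nlinarith
  set cF : ℝ := M₂ * (∑ j, ‖b j‖) * Cq + 1 with hcFdef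
  have hcF : 0 < cF := by rw [hcFdef]; nlinarith [mul_nonneg (mul_nonneg hM₂ hSb) hCq]
  obtain ⟨aC, haC, H34⟩ := thm34_Cinv_uniform_blk b (Fin (d + 1)) dB δ₀ κQ BG C₂ cF Cq 1 1 M₂ (fun _ => ((ℓ : ℝ) + 1) ^ 4) hκQ hBG hC₂ hcF hCq
    zero_le_one hM₂ hδ₀ hΛf hrepr
  have hc1 : 0 ≤ B6.c1 dB (2 / 5 * δ₀) (1 / 10) := c1_nonneg _ _ _
  refine ⟨9 / 25 * δ₀, 2 * C₂ * B6.c1 dB (2 / 5 * δ₀) (1 / 10) + 1, max M₂' MG, max (4 * Real.log ((ℓ : ℝ) + 1) / (9 / 5000 * δ₀)) TG,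
    max (N1 d ℓ (9 / 5000 * δ₀)) NG, by positivity, by positivity, aC, haC, ?_⟩
  intro hd hL b₀ b₁ i c Rr H hM hN hT α₁ hα0 hα1 A kF sF V hkF hsF h337B hA hAτB hparV hF hFs
  -- thresholds
  have hM2 : M₂' ≤ ((ℓ : ℝ) + 1) * (toKT i).Mh := (le_max_left _ _).trans hM
  have hMG : MG ≤ ((ℓ : ℝ) + 1) * (toKT i).Mh := (le_max_right _ _).trans hM
  have hN2 : N1 d ℓ (9 / 5000 * δ₀) + 1 ≤ (toKT i).R * ((ℓ + 1) * (toKT i).Mh) := le_trans (Nat.succ_le_succ (le_max_left _ _)) hN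
  have hNG : NG + 1 ≤ (toKT i).R * ((ℓ + 1) * (toKT i).Mh) := le_trans (Nat.succ_le_succ (le_max_right _ _)) hN
  have hT2 : 4 * Real.log ((ℓ : ℝ) + 1) / (9 / 5000 * δ₀) ≤ RM1 i := (le_max_left _ _).trans hT
  have hTG : TG ≤ RM1 i := (le_max_right _ _).trans hT
  -- geometry of the cube sequence (r05 FILE 5a)
  haveI : Nonempty (geoCK i c).Site := geoCK_site_nonempty i c
  obtain ⟨hdnn, htri, hrefl, hsym⟩ := geoCK_dist_axioms i c Rr H
  obtain ⟨hd₀B, hd₀F, hd₀0⟩ := stencil_geoCK i c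
  -- Theorem 3.1 (3.42)₁,₂ for `GpDirK` at the knit cube legs, rate weakened to `δ₀` (UNIT 2 (b))
  obtain ⟨-, e1, e2, -, -⟩ := hG i c Rr H (parKnitCubeY i c) (parKnitCubeY_one i c) hMG hNG hTG
  have g342_1 : HasMajorant (g := toB6 (geoCK i c) Rr H) (fun p : SiteY i × ι => blkCubeY i c p.1) (GpDirK b i c (parKnitCubeY i c))
      (fun a a' => BG * (geoCK i c).len a ^ 2 * Real.exp (-(δ₀ * (geoCK i c).dist a a'))) :=
    hasMajorant_mono (g := toB6 (geoCK i c) Rr H) _ e1 fun a a' => kernel_rate_mono hdnn hδ₀1 (mul_nonneg hBG.le (sq_nonneg _)) a a'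
  have g342_2 : ∀ k : Fin (d + 1) ⊕ Fin (d + 1), HasMajorant (g := toB6 (geoCK i c) Rr H) (fun p : SiteY i × ι => blkCubeY i c p.1)
      (conj b (diffLetter (shiftY i) (fun _ _ => (1 : 𝔸ˣ)) ((((geoCK i c).eta : ℂ))⁻¹) k) * GpDirK b i c (parKnitCubeY i c))
      (fun a a' => BG * (geoCK i c).len a * Real.exp (-(δ₀ * (geoCK i c).dist a a'))) := fun k =>
    hasMajorant_mono (g := toB6 (geoCK i c) Rr H) _ (e2 k) fun a a' => kernel_rate_mono hdnn hδ₀1 (mul_nonneg hBG.le (geoCK_len_pos i c a).le) a a'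
  -- the (3.19) letters at `U = 1` on the carrier (U6b-ii), constant `κ_Q`
  have hκle : M₂ * (∑ j, ‖b j‖) ≤ κQ := by rw [hκQdef]; linarith
  have hpar1 : ∀ z w : SiteY i, ‖((parKnitCubeY i c (fun _ _ => 1) z w : 𝔸ˣ) : 𝔸)‖ ≤ 1 ∧
      ‖(((parKnitCubeY i c (fun _ _ => 1) z w)⁻¹ : 𝔸ˣ) : 𝔸)‖ ≤ 1 := fun z w => by
    rw [parKnitCubeY_one i c z w, inv_one, Units.val_one]; exact ⟨h1, h1⟩
  have hQc := hasMajorantHom_mono (g := toB6 (geoCK i c) Rr H) _ _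
    (hasMajorantHom_QcR b i c (fun _ _ => 1) (Rr := Rr) (Hp := H) hpar1 hM₂ hrepr)
    (K' := fun a a' : BlkCubeY i c => κQ * (if a = a' then (1 : ℝ) else 0)) fun a a' => by
      split_ifs
      · rw [mul_one]; exact hκle
      · rw [mul_zero]
  have hQcs := hasMajorantHom_mono (g := toB6 (geoCK i c) Rr H) _ _
    (hasMajorantHom_QcsR b i c (fun _ _ => 1) (Rr := Rr) (Hp := H) hpar1 hM₂ hrepr)
    (K' := fun a a' : BlkCubeY i c => κQ * (if a = a' then (1 : ℝ) else 0)) fun a a' => by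
      split_ifs
      · rw [mul_one]; exact hκle
      · rw [mul_zero]
  -- Theorem 3.2 at `U = 1` on the carrier (U6b-i): the law and the (3.48) majorant at the rate `δ₀`
  have hLinv := hLinv_CinvR b i c
  have h348 : HasMajorant (g := toB6 (geoCK i c) Rr H) (fun q : ↥(SBlk i c) × ι => (q.1 : BlkCubeY i c)) (CinvR b i c (fun _ _ => 1))
      (fun a a' => C₂ * (geoCK i c).len a ^ (-(4 : ℝ)) * Real.exp (-(δ₀ * (geoCK i c).dist a a'))) :=
    hasMajorant_mono (g := toB6 (geoCK i c) Rr H) _ (h32 i c Rr H hM2)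
      fun a a' => kernel_rate_mono hdnn hδ₀2 (mul_nonneg hC₂.le (Real.rpow_nonneg (geoCK_len_pos i c a).le _)) a a'
  -- the (3.57) letters on the carrier (U6b-ii), constant `c_F·α₁`
  have hcle : M₂ * (∑ j, ‖b j‖) * (Cq * α₁) ≤ cF * α₁ := by
    rw [hcFdef]; nlinarith [mul_nonneg (mul_nonneg hM₂ hSb) hCq]
  have hFc := hasMajorantHom_mono (g := toB6 (geoCK i c) Rr H) _ _
    (hasMajorantHom_FcR b i c V (Rr := Rr) (Hp := H) hM₂ hrepr (by positivity) hF)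
    (K' := fun a a' : BlkCubeY i c => cF * α₁ * (if a = a' then (1 : ℝ) else 0)) fun a a' => by
      split_ifs
      · rw [mul_one]; exact hcle
      · rw [mul_zero]
  have hFcs := hasMajorantHom_mono (g := toB6 (geoCK i c) Rr H) _ _
    (hasMajorantHom_FcsR b i c V (Rr := Rr) (Hp := H) hM₂ hrepr (by positivity) hFs)
    (K' := fun a a' : BlkCubeY i c => cF * α₁ * (if a = a' then (1 : ℝ) else 0)) fun a a' => by
      split_ifs
      · rw [mul_one]; exact hcle
      · rw [mul_zero]
  -- r06's `C`-clause on the Dirichlet carrier `(𝔖 × ι, val ∘ fst)`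
  obtain ⟨Tinv, hT1, hT2', hTm⟩ := H34 (shiftY i) (fun _ _ => (1 : 𝔸ˣ)) (g := geoCK i c) (Rr := Rr) (H := H) (blkCubeY i c)
    (fun q : ↥(SBlk i c) × ι => (q.1 : BlkCubeY i c)) (kQCubeY i c (parKnitCubeY i c) (fun _ _ => 1)) (sQCubeY i c (parKnitCubeY i c) (fun _ _ => 1))
    (cfunK i c) (wK i c)
    hdnn htri hrefl hsym (geoCK_len_pos i c) (geoCK_eta_le_len i c) (geoCK_eta_pos i c)
    (fun α hα hα1 => h261 i c Rr H hN2 α hα hα1.le) (hST_geoCK i c hδ₀ hT2)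
    (fun _ _ => ⟨h1, by rw [inv_one, Units.val_one]; exact h1⟩) hd₀B hd₀F hd₀0 (wK_nonneg i c) (card_block_mul_wK_le i c)
    (fun y x hx => by rw [← hx]; exact norm_kQCubeY_one_le i c (parKnitCubeY i c) h1 (parKnitCubeY_one i c) _ x)
    (norm_sQCubeY_one_le i c (parKnitCubeY i c) h1 (parKnitCubeY_one i c)) (abs_cfunK_le i c)
    g342_1 g342_2 hQc hQcs hLinv h348 α₁ hα0 hα1 A kF sF hkF hsF h337B hA hAτB (QcR_eq_add b i c V) (QcsR_eq_add b i c V) hFc hFcs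
  refine ⟨Tinv, hT1, hT2', hasMajorant_mono (g := toB6 (geoCK i c) Rr H) _ hTm fun a a' => ?_⟩
  have hℓ4 : 0 ≤ (geoCK i c).len a ^ (-(4 : ℝ)) := Real.rpow_nonneg (geoCK_len_pos i c a).le _
  have hexp : 0 ≤ Real.exp (-(9 / 25 * δ₀ * (geoCK i c).dist a a')) := (Real.exp_pos _).le
  nlinarith [mul_nonneg hℓ4 hexp]

end Literature.MathematicalPhysics.QuantumFieldTheory.Balaban1983to89.B9Cor35CDirEngineAtCarrier
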